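import Summits.CriticalPhenomena.CardyFormulaZ2.Theorems.CardyBoundaryCoulombGasHalfPlaneMarkDensityLawSubsequentialLimits
import Summits.CriticalPhenomena.CardyFormulaZ2.Theorems.CardyBoundaryCoulombGasHalfPlaneMarkDensityLawBoxExhaustionPart5

/-!
# Line `Sketch`, open stub C⁺ — a priori structure of the collinear half-plane crossing function, VIII:
# it suffices to prove C⁺ for INTEGER marks (crux stmt-CriticalPhenomena-5661, lead c2-0)

`P_n(a,b,c,y) := P_{1/2}[[⌊an⌋,⌊bn⌋]×{0} ↔ [⌊cn⌋,⌊yn⌋]×{0} in ℤ×ℕ]`.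

* §16 two lattice configurations whose endpoints differ by `≤ m` sites differ in probability by
  `≤ 8C(m/R)^α` (`abs_sub_le_of_near`: both are dominated by their common upper corner, `move_le`).
* §17 convergence along the multiples `q·k` of a fixed `q ≥ 1` gives convergence of the full sequence
  (`tendsto_of_tendsto_multiples`): `⌊a n⌋` and `⌊a q⌊n/q⌋⌋` differ by `≤ |a| q + 1` sites.
* §18 C⁺ for RATIONAL marks gives C⁺ (`collinearCardy_of_rat`: `δ`-move sandwich between rational
  corners + continuity of `F ∘ η`).
* §19 **C⁺ for INTEGER marks gives C⁺** (`collinearCardy_iff_int`, and for the crux by name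
  `halfPlaneMarkDensityLaw_iff_int` = registered `stub_integerMarks`): it is enough to show, for
  integers `A < B < C < Y`, `P_{1/2}[[AN,BN]×{0} ↔ [CN,YN]×{0} in ℤ×ℕ] → F(η(A,B,C,Y))` as `N → ∞` —
  exact integer arcs, no floors (rational marks `Z/q` are integer marks at the scales `qk`).
-/

noncomputable section

namespace Summit.CriticalPhenomena.CardyFormulaZ2.Cruxes.HalfPlaneMarkDensityLaw.SketchLine

open Literature.Probability.Percolation Literature.Probability.LatticeModels
open Literature.Probability.RandomPlanarGeometry (crossRatio cardyFunction)
open MeasureTheory Filter Set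
open scoped Topology
open Summit.CriticalPhenomena.CardyFormulaZ2.Theses.CardyBoundaryCoulombGas (HalfPlaneMarkDensityLaw)
open Summit.CriticalPhenomena.CardyFormulaZ2.Theorems.HalfPlaneMarkDensityLaw.Negative

namespace Subseq

/-- Cardy's function `F` (the `RandomPlanarGeometry` copy). -/
local notation "𝔽" => Literature.Probability.RandomPlanarGeometry.cardyFunction

/-! ## §16 Near lattice configurations -/

section Near

variable {C α : ℝ}
  (hesc : ∀ p : unitInterval, (p : ℝ) ≤ 1 / 2 → ∀ r R : ℕ, 1 ≤ r → r ≤ R →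
    (bondPercolation (zdGraph 2) p).real
      {ω | ∃ x ∈ box 2 r, ∃ y ∉ box 2 R, ω ∈ openConnIn Set.univ x y} ≤ C * ((r : ℝ) / R) ^ α)
include hesc

/-- **Near configurations.** Two pairs of arcs whose four endpoints differ by `≤ m` sites have
crossing probabilities within `8C(m/R)^α`, `m ≤ R ≤` (smaller gap) `− 2`: both are dominated by their
common upper corner (`move_le` twice). [folklore] -/
theorem abs_sub_le_of_near {i j k l i' j' k' l' : ℤ} {m R : ℕ} (hm : 1 ≤ m) (hmR : m ≤ R)
    (hij : i ≤ j) (hkl : k ≤ l) (hij' : i' ≤ j') (hkl' : k' ≤ l')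
    (di : |i - i'| ≤ m) (dj : |j - j'| ≤ m) (dk : |k - k'| ≤ m) (dl : |l - l'| ≤ m)
    (hR : (R : ℤ) ≤ min k k' - max j j' - 2) :
    |μ.real (openCrossing halfPlane (rowIcc i j) (rowIcc k l)) -
        μ.real (openCrossing halfPlane (rowIcc i' j') (rowIcc k' l'))| ≤ 8 * (C * ((m : ℝ) / R) ^ α) := by
  have hi := abs_le.1 di; have hj := abs_le.1 dj; have hk := abs_le.1 dk; have hl := abs_le.1 dl
  have hA := move_le hesc (i := i) (j := j) (k := k) (l := l) (i' := min i i') (j' := max j j')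
    (k' := min k k') (l' := max l l') (m := m) (R := R) (min_le_left _ _) (le_max_left _ _)
    (min_le_left _ _) (le_max_left _ _) hij hkl hm hmR (by omega) (by omega) (by omega) (by omega) hR
  have hB := move_le hesc (i := i') (j := j') (k := k') (l := l') (i' := min i i') (j' := max j j')
    (k' := min k k') (l' := max l l') (m := m) (R := R) (min_le_right _ _) (le_max_right _ _)
    (min_le_right _ _) (le_max_right _ _) hij' hkl' hm hmR (by omega) (by omega) (by omega) (by omega) hR
  rw [abs_le]
  constructor <;> linarith [hA.1, hA.2, hB.1, hB.2]

end Near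

/-! ## §17 From the multiples of `q` to the full sequence -/

/-- `⌊a n⌋` and `⌊a (q ⌊n/q⌋)⌋` differ by at most `|a| q + 1`. [folklore] -/
theorem abs_floor_sub_floor_mul_div_le (a : ℝ) {q : ℕ} (hq : 1 ≤ q) (n : ℕ) :
    |⌊a * n⌋ - ⌊a * ((q * (n / q) : ℕ) : ℝ)⌋| ≤ ((⌈|a| * q⌉₊ + 1 : ℕ) : ℤ) := by
  have hdiv : (q * (n / q) : ℕ) ≤ n := Nat.mul_div_le n q
  have hmod : n < q * (n / q) + q := by
    have := Nat.div_add_mod n q; have := Nat.mod_lt n (by omega : 0 < q); linarith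
  set n' : ℕ := q * (n / q) with hn'
  have hdiff : (0 : ℝ) ≤ (n : ℝ) - n' ∧ (n : ℝ) - n' ≤ q := by
    constructor
    · exact sub_nonneg.2 (by exact_mod_cast hdiv)
    · have : (n : ℝ) < (n' : ℝ) + q := by exact_mod_cast hmod
      linarith
  have h1 : (⌊a * n⌋ : ℝ) ≤ a * n := Int.floor_le _
  have h2 : a * n < ⌊a * n⌋ + 1 := Int.lt_floor_add_one _
  have h3 : (⌊a * (n' : ℝ)⌋ : ℝ) ≤ a * n' := Int.floor_le _
  have h4 : a * (n' : ℝ) < ⌊a * (n' : ℝ)⌋ + 1 := Int.lt_floor_add_one _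
  have h5 : |a * n - a * n'| ≤ |a| * q := by
    rw [← mul_sub, abs_mul]
    exact mul_le_mul_of_nonneg_left (by rw [abs_of_nonneg hdiff.1]; exact hdiff.2) (abs_nonneg a)
  have h6 : |a| * q ≤ ⌈|a| * q⌉₊ := Nat.le_ceil _
  have habs := abs_le.1 h5
  rw [abs_le]
  constructor
  · have : ((-((⌈|a| * q⌉₊ + 1 : ℕ) : ℤ) : ℤ) : ℝ) < ((⌊a * n⌋ - ⌊a * (n' : ℝ)⌋ : ℤ) : ℝ) := by
      push_cast; linarith
    exact (Int.cast_lt.1 this).le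
  · have : ((⌊a * n⌋ - ⌊a * (n' : ℝ)⌋ : ℤ) : ℝ) < (((⌈|a| * q⌉₊ + 1 : ℕ) : ℤ) : ℝ) := by
      push_cast; linarith
    exact (Int.cast_lt.1 this).le

/-- **Multiples suffice.** If `P_{qk}(a,b,c,y) → L` as `k → ∞` for some `q ≥ 1`, then
`P_n(a,b,c,y) → L` as `n → ∞`. [folklore] -/
theorem tendsto_of_tendsto_multiples {a b c y L : ℝ} (hab : a ≤ b) (hbc : b < c) (hcy : c ≤ y)
    {q : ℕ} (hq : 1 ≤ q)
    (h : Tendsto (fun k : ℕ ↦ μ.real (openCrossing halfPlane (arcA a b (q * k))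
      (rowIcc ⌊c * ((q * k : ℕ) : ℝ)⌋ ⌊y * ((q * k : ℕ) : ℝ)⌋))) atTop (𝓝 L)) :
    Tendsto (fun n : ℕ ↦ μ.real (openCrossing halfPlane (arcA a b n) (rowIcc ⌊c * n⌋ ⌊y * n⌋)))
      atTop (𝓝 L) := by
  obtain ⟨C, α, -, hα, hesc⟩ := exists_real_boxToFar_le_rpow_of_le_half
  -- the comparison sequence along n ↦ q ⌊n/q⌋
  have hdiv : Tendsto (fun n : ℕ ↦ n / q) atTop atTop :=
    tendsto_atTop_atTop.2 fun N ↦ ⟨q * N, fun n hn ↦ (Nat.le_div_iff_mul_le (by omega)).2 (by nlinarith)⟩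
  have h' := h.comp hdiv
  -- a common displacement bound
  set m : ℕ := max (max (⌈|a| * q⌉₊ + 1) (⌈|b| * q⌉₊ + 1)) (max (⌈|c| * q⌉₊ + 1) (⌈|y| * q⌉₊ + 1))
    with hm
  have hm1 : 1 ≤ m := by rw [hm]; omega
  have hma : ((⌈|a| * q⌉₊ + 1 : ℕ) : ℤ) ≤ m := by
    rw [hm]; exact_mod_cast le_max_of_le_left (le_max_left _ _)
  have hmb : ((⌈|b| * q⌉₊ + 1 : ℕ) : ℤ) ≤ m := by
    rw [hm]; exact_mod_cast le_max_of_le_left (le_max_right _ _)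
  have hmc : ((⌈|c| * q⌉₊ + 1 : ℕ) : ℤ) ≤ m := by
    rw [hm]; exact_mod_cast le_max_of_le_right (le_max_left _ _)
  have hmy : ((⌈|y| * q⌉₊ + 1 : ℕ) : ℤ) ≤ m := by
    rw [hm]; exact_mod_cast le_max_of_le_right (le_max_right _ _)
  have hg : 0 < c - b := by linarith
  -- the difference tends to 0
  have hdiff : Tendsto (fun n : ℕ ↦ μ.real (openCrossing halfPlane (arcA a b n) (rowIcc ⌊c * n⌋ ⌊y * n⌋)) -
      μ.real (openCrossing halfPlane (arcA a b (q * (n / q)))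
        (rowIcc ⌊c * ((q * (n / q) : ℕ) : ℝ)⌋ ⌊y * ((q * (n / q) : ℕ) : ℝ)⌋))) atTop (𝓝 0) := by
    have herr : Tendsto (fun n : ℕ ↦ 8 * (C * ((m : ℝ) / ⌊(c - b) * n / 2⌋₊) ^ α)) atTop (𝓝 0) := by
      have := tendsto_translate_error (C * (m : ℝ) ^ α) hα hg
      refine this.congr' ?_
      filter_upwards [(tendsto_natCast_atTop_atTop.const_mul_atTop hg).eventually_ge_atTop 4] with n hn
      have hR : (0 : ℝ) < ⌊(c - b) * n / 2⌋₊ := by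
        have := Nat.sub_one_lt_floor ((c - b) * n / 2); linarith
      rw [Real.div_rpow (Nat.cast_nonneg m) hR.le, one_div, Real.inv_rpow hR.le]; ring
    refine squeeze_zero_norm' ?_ herr
    have h2 : Tendsto (fun n : ℕ ↦ q * (n / q)) atTop atTop :=
      tendsto_atTop_mono (fun n ↦ Nat.le_mul_of_pos_left _ (by omega)) hdiv
    have e1 : ∀ᶠ n : ℕ in atTop, (c - b) * q + 4 * m + 8 ≤ (c - b) * ((q * (n / q) : ℕ) : ℝ) := by
      have := ((tendsto_natCast_atTop_atTop (R := ℝ)).comp h2).const_mul_atTop hg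
      have := this.eventually_ge_atTop ((c - b) * q + 4 * m + 8)
      filter_upwards [this] with n hn
      simpa only [Function.comp_apply] using hn
    filter_upwards [e1] with n hn
    rw [Real.norm_eq_abs]
    set n' : ℕ := q * (n / q) with hn'
    have hn'n : (n' : ℝ) ≤ n := by exact_mod_cast Nat.mul_div_le n q
    have hnq : (n : ℝ) < n' + q := by
      have h1 := Nat.div_add_mod n q
      have h2 := Nat.mod_lt n (by omega : 0 < q)
      have : n < q * (n / q) + q := by omega
      rw [hn']; exact_mod_cast this
    set R : ℕ := ⌊(c - b) * n / 2⌋₊ with hR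
    have hR_le : (R : ℝ) ≤ (c - b) * n / 2 := Nat.floor_le (by positivity)
    have hR_ge : (c - b) * n / 2 - 1 < R := by rw [hR]; exact Nat.sub_one_lt_floor _
    have hmR_real : (m : ℝ) ≤ R := by nlinarith
    have hmR : m ≤ R := by exact_mod_cast hmR_real
    have hb1 : (b * (n' : ℝ)) < ⌊b * (n' : ℝ)⌋ + 1 := Int.lt_floor_add_one _
    have hc1 : (⌊c * (n' : ℝ)⌋ : ℝ) ≤ c * n' := Int.floor_le _
    have hb2 : (b * (n : ℝ)) < ⌊b * (n : ℝ)⌋ + 1 := Int.lt_floor_add_one _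
    have hc2 : (⌊c * (n : ℝ)⌋ : ℝ) ≤ c * n := Int.floor_le _
    have hc3 : (c * (n : ℝ)) < ⌊c * (n : ℝ)⌋ + 1 := Int.lt_floor_add_one _
    have hc4 : (c * (n' : ℝ)) < ⌊c * (n' : ℝ)⌋ + 1 := Int.lt_floor_add_one _
    have hb3 : (⌊b * (n : ℝ)⌋ : ℝ) ≤ b * n := Int.floor_le _
    have hb4 : (⌊b * (n' : ℝ)⌋ : ℝ) ≤ b * n' := Int.floor_le _
    have hRgap : (R : ℤ) ≤ min ⌊c * (n : ℝ)⌋ ⌊c * (n' : ℝ)⌋ - max ⌊b * (n : ℝ)⌋ ⌊b * (n' : ℝ)⌋ - 2 := by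
      have dc := abs_le.1 ((abs_floor_sub_floor_mul_div_le c hq n).trans hmc)
      have db := abs_le.1 ((abs_floor_sub_floor_mul_div_le b hq n).trans hmb)
      have key : ((R : ℤ) : ℝ) < ((⌊c * (n' : ℝ)⌋ - ⌊b * (n' : ℝ)⌋ - 2 - 2 * m : ℤ) : ℝ) := by
        push_cast
        have hq0 : (0 : ℝ) ≤ q := Nat.cast_nonneg q
        nlinarith [mul_le_mul_of_nonneg_left hnq.le hg.le]
      have := Int.cast_lt.1 key
      rw [← hn'] at dc db
      omega
    exact abs_sub_le_of_near hesc hm1 hmR (floor_mul_le_floor_mul hab n) (floor_mul_le_floor_mul hcy n)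
      (floor_mul_le_floor_mul hab _) (floor_mul_le_floor_mul hcy _)
      ((abs_floor_sub_floor_mul_div_le a hq n).trans hma) ((abs_floor_sub_floor_mul_div_le b hq n).trans hmb)
      ((abs_floor_sub_floor_mul_div_le c hq n).trans hmc) ((abs_floor_sub_floor_mul_div_le y hq n).trans hmy)
      hRgap
  have := h'.add hdiff
  simp only [add_zero] at this
  refine this.congr fun n ↦ ?_
  simp only [Function.comp_apply]
  ring

/-! ## §18 C⁺ for rational marks gives C⁺ -/

/-- `F ∘ η` is continuous at every point of the chamber (as a function of the mark vector). [folklore] -/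
theorem continuousAt_cardy_crossRatio {a b c y : ℝ} (hab : a < b) (hbc : b < c) (hcy : c < y) :
    ContinuousAt (fun x : Fin 4 → ℝ ↦ 𝔽 (crossRatio x)) ![a, b, c, y] := by
  have hsm : StrictMono (![a, b, c, y] : Fin 4 → ℝ) := by
    refine Fin.strictMono_iff_lt_succ.2 fun i ↦ ?_
    fin_cases i <;> simp [hab, hbc, hcy]
  have h1 := BoxExhaustion.continuousAt_crossRatio (BoxExhaustion.crossRatio_den_ne_zero hsm)
  have hη := crossRatio_four_mem_Ioo hab hbc hcy
  have h2 : ContinuousAt Literature.Probability.RandomPlanarGeometry.cardyFunction (crossRatio ![a, b, c, y]) :=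
    Literature.Probability.RandomPlanarGeometry.continuousOn_cardyFunction_Ioo.continuousAt
      (Ioo_mem_nhds hη.1 hη.2)
  exact h2.comp h1

/-- **Rational marks suffice.** If `P_n(q) → F(η(q))` for every rational quadruple of the chamber,
then C⁺ holds (monotonicity sandwich between rational corners + continuity of `F ∘ η`). [folklore] -/
theorem collinearCardy_of_rat
    (hrat : ∀ q : ℚ × ℚ × ℚ × ℚ, (q.1 : ℝ) < q.2.1 → (q.2.1 : ℝ) < q.2.2.1 → (q.2.2.1 : ℝ) < q.2.2.2 →
      Tendsto (fun n : ℕ ↦ μ.real (openCrossing halfPlane (arcA q.1 q.2.1 n)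
        (rowIcc ⌊(q.2.2.1 : ℝ) * n⌋ ⌊(q.2.2.2 : ℝ) * n⌋))) atTop
        (𝓝 (𝔽 (crossRatio ![(q.1 : ℝ), q.2.1, q.2.2.1, q.2.2.2])))) :
    ∀ a b c y : ℝ, a < b → b < c → c < y →
      Tendsto (fun n : ℕ ↦ μ.real (openCrossing halfPlane (arcA a b n) (rowIcc ⌊c * n⌋ ⌊y * n⌋))) atTop
        (𝓝 (𝔽 (crossRatio ![a, b, c, y]))) := by
  intro a b c y hab hbc hcy
  set L := 𝔽 (crossRatio ![a, b, c, y]) with hL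
  rw [Metric.tendsto_atTop]
  intro ε hε
  -- continuity of F ∘ η at the marks
  obtain ⟨δ₁, hδ₁, hcont⟩ := Metric.continuousAt_iff.1 (continuousAt_cardy_crossRatio hab hbc hcy) (ε / 2)
    (by positivity)
  set δ := min (δ₁ / 2) (min (min ((b - a) / 2) ((y - c) / 2)) ((c - b) / 2)) with hδ
  have hδ0 : 0 < δ := by
    rw [hδ]; exact lt_min (by positivity) (lt_min (lt_min (by linarith) (by linarith)) (by linarith))
  have hδδ₁ : δ < δ₁ := lt_of_le_of_lt (min_le_left _ _) (by linarith)
  have hδ1 : δ ≤ (b - a) / 2 := (min_le_right _ _).trans ((min_le_left _ _).trans (min_le_left _ _))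
  have hδ2 : δ ≤ (y - c) / 2 := (min_le_right _ _).trans ((min_le_left _ _).trans (min_le_right _ _))
  have hδ3 : δ ≤ (c - b) / 2 := (min_le_right _ _).trans (min_le_right _ _)
  -- rational corners
  obtain ⟨ap, ha1, ha2⟩ := exists_rat_btwn (show a - δ < a by linarith)
  obtain ⟨bp, hb1, hb2⟩ := exists_rat_btwn (show b < b + δ by linarith)
  obtain ⟨cp, hc1, hc2⟩ := exists_rat_btwn (show c - δ < c by linarith)
  obtain ⟨yp, hy1, hy2⟩ := exists_rat_btwn (show y < y + δ by linarith)
  obtain ⟨am, ha3, ha4⟩ := exists_rat_btwn (show a < a + δ by linarith)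
  obtain ⟨bm, hb3, hb4⟩ := exists_rat_btwn (show b - δ < b by linarith)
  obtain ⟨cm, hc3, hc4⟩ := exists_rat_btwn (show c < c + δ by linarith)
  obtain ⟨ym, hy3, hy4⟩ := exists_rat_btwn (show y - δ < y by linarith)
  -- their limits are within ε/2 of L
  have hdp : dist (![(ap : ℝ), bp, cp, yp] : Fin 4 → ℝ) ![a, b, c, y] < δ₁ := by
    rw [dist_pi_lt_iff hδ₁]
    intro i; fin_cases i <;> simp [Real.dist_eq, abs_lt] <;> constructor <;> linarith
  have hdm : dist (![(am : ℝ), bm, cm, ym] : Fin 4 → ℝ) ![a, b, c, y] < δ₁ := by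
    rw [dist_pi_lt_iff hδ₁]
    intro i; fin_cases i <;> simp [Real.dist_eq, abs_lt] <;> constructor <;> linarith
  have hLp := hcont hdp
  have hLm := hcont hdm
  rw [Real.dist_eq, abs_lt] at hLp hLm
  -- convergence at the corners
  have hp := (Metric.tendsto_atTop.1 (hrat (ap, bp, cp, yp) (by push_cast; linarith)
    (by push_cast; linarith) (by push_cast; linarith))) (ε / 2) (by positivity)
  have hm := (Metric.tendsto_atTop.1 (hrat (am, bm, cm, ym) (by push_cast; linarith)
    (by push_cast; linarith) (by push_cast; linarith))) (ε / 2) (by positivity)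
  obtain ⟨N₁, hN₁⟩ := hp
  obtain ⟨N₂, hN₂⟩ := hm
  refine ⟨max N₁ N₂, fun n hn ↦ ?_⟩
  have h1 := hN₁ n (le_of_max_le_left hn)
  have h2 := hN₂ n (le_of_max_le_right hn)
  simp only at h1 h2
  rw [Real.dist_eq, abs_lt] at h1 h2 ⊢
  have lo := P_mono (a := (am : ℝ)) (a' := a) (b := (bm : ℝ)) (b' := b) (c := (cm : ℝ)) (c' := c)
    (y := (ym : ℝ)) (y' := y) (by linarith) (by linarith) (by linarith) (by linarith) n
  have hi := P_mono (a := a) (a' := (ap : ℝ)) (b := b) (b' := (bp : ℝ)) (c := c) (c' := (cp : ℝ))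
    (y := y) (y' := (yp : ℝ)) (by linarith) (by linarith) (by linarith) (by linarith) n
  constructor <;> linarith [h1.1, h1.2, h2.1, h2.2, hLp.1, hLp.2, hLm.1, hLm.2]

/-! ## §19 C⁺ for integer marks gives C⁺ -/

/-- The cross-ratio is dilation invariant. [folklore] -/
theorem crossRatio_smul {s a b c y : ℝ} (hs : s ≠ 0) :
    crossRatio ![s * a, s * b, s * c, s * y] = crossRatio ![a, b, c, y] := by
  rw [crossRatio_four, crossRatio_four,
    show (s * a - s * b) * (s * c - s * y) = s ^ 2 * ((a - b) * (c - y)) by ring,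
    show (s * a - s * c) * (s * b - s * y) = s ^ 2 * ((a - c) * (b - y)) by ring,
    mul_div_mul_left _ _ (pow_ne_zero 2 hs)]

/-- For integer marks the arcs are exact: `⌊A N⌋ = A N`. [folklore] -/
theorem floor_intCast_mul_natCast (A : ℤ) (N : ℕ) : ⌊(A : ℝ) * (N : ℝ)⌋ = A * N := by
  rw [show (A : ℝ) * (N : ℝ) = ((A * N : ℤ) : ℝ) by push_cast; ring, Int.floor_intCast]

/-- A rational times a common denominator is an integer (as reals). [folklore] -/
theorem rat_mul_dens (r : ℚ) (d : ℕ) : ((r.num * d : ℤ) : ℝ) = (r : ℝ) * ((r.den * d : ℕ) : ℝ) := by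
  have hden : (r.den : ℝ) ≠ 0 := by exact_mod_cast r.den_ne_zero
  rw [Rat.cast_def]
  push_cast
  field_simp

/-- **Integer marks suffice.**  C⁺ holds iff, for all integers `A < B < C < Y`,
`P_{1/2}[[AN,BN]×{0} ↔ [CN,YN]×{0} in ℤ×ℕ] → F(η(A,B,C,Y))` as `N → ∞` — exact integer arcs, no
floors.  (`⟸`: a rational quadruple with common denominator `q` is an integer quadruple at the
scales `qk`; `tendsto_of_tendsto_multiples` gives the full sequence; `collinearCardy_of_rat` the real
marks.) [folklore] -/
theorem collinearCardy_iff_int :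
    (∀ a b c y : ℝ, a < b → b < c → c < y →
      Tendsto (fun n : ℕ ↦ μ.real (openCrossing halfPlane (arcA a b n) (rowIcc ⌊c * n⌋ ⌊y * n⌋))) atTop
        (𝓝 (𝔽 (crossRatio ![a, b, c, y])))) ↔
    ∀ A B C Y : ℤ, A < B → B < C → C < Y →
      Tendsto (fun N : ℕ ↦ μ.real (openCrossing halfPlane (rowIcc (A * N) (B * N)) (rowIcc (C * N) (Y * N))))
        atTop (𝓝 (𝔽 (crossRatio ![(A : ℝ), B, C, Y]))) := by
  constructor
  · intro hC A B C Y hAB hBC hCY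
    have h := hC A B C Y (by exact_mod_cast hAB) (by exact_mod_cast hBC) (by exact_mod_cast hCY)
    refine h.congr fun N ↦ ?_
    simp only [arcA_eq_rowIcc, floor_intCast_mul_natCast]
  · intro hZ
    apply collinearCardy_of_rat
    rintro ⟨ra, rb, rc, ry⟩ hab hbc hcy
    simp only at hab hbc hcy ⊢
    -- common denominator and integer marks
    set q : ℕ := ra.den * (rb.den * (rc.den * ry.den)) with hq
    have hq1 : 1 ≤ q := by
      rw [hq]; exact Nat.mul_pos ra.den_pos (Nat.mul_pos rb.den_pos (Nat.mul_pos rc.den_pos ry.den_pos))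
    set A : ℤ := ra.num * (rb.den * (rc.den * ry.den) : ℕ) with hA
    set B : ℤ := rb.num * (ra.den * (rc.den * ry.den) : ℕ) with hB
    set Cc : ℤ := rc.num * (ra.den * (rb.den * ry.den) : ℕ) with hCc
    set Y : ℤ := ry.num * (ra.den * (rb.den * rc.den) : ℕ) with hY
    have eA : (A : ℝ) = (ra : ℝ) * q := by
      rw [hA, rat_mul_dens, hq]
    have eB : (B : ℝ) = (rb : ℝ) * q := by
      rw [hB, rat_mul_dens, hq]; push_cast; ring
    have eC : (Cc : ℝ) = (rc : ℝ) * q := by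
      rw [hCc, rat_mul_dens, hq]; push_cast; ring
    have eY : (Y : ℝ) = (ry : ℝ) * q := by
      rw [hY, rat_mul_dens, hq]; push_cast; ring
    have hq0 : (0 : ℝ) < q := by exact_mod_cast hq1
    have hAB : A < B := by
      have : (A : ℝ) < B := by rw [eA, eB]; exact mul_lt_mul_of_pos_right hab hq0
      exact_mod_cast this
    have hBC : B < Cc := by
      have : (B : ℝ) < Cc := by rw [eB, eC]; exact mul_lt_mul_of_pos_right hbc hq0
      exact_mod_cast this
    have hCY : Cc < Y := by
      have : (Cc : ℝ) < Y := by rw [eC, eY]; exact mul_lt_mul_of_pos_right hcy hq0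
      exact_mod_cast this
    have h := hZ A B Cc Y hAB hBC hCY
    -- the cross-ratio of the integer marks is that of the rational ones
    have hcr : crossRatio ![(A : ℝ), B, Cc, Y] = crossRatio ![(ra : ℝ), rb, rc, ry] := by
      rw [eA, eB, eC, eY, show (ra : ℝ) * q = q * ra by ring, show (rb : ℝ) * q = q * rb by ring,
        show (rc : ℝ) * q = q * rc by ring, show (ry : ℝ) * q = q * ry by ring, crossRatio_smul hq0.ne']
    rw [hcr] at h
    -- along the multiples q k the rational arcs are the integer ones
    refine tendsto_of_tendsto_multiples hab.le hbc hcy.le hq1 (h.congr fun k ↦ ?_)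
    have e : ∀ (r : ℚ) (Z : ℤ), (Z : ℝ) = (r : ℝ) * q → ⌊(r : ℝ) * ((q * k : ℕ) : ℝ)⌋ = Z * k := by
      intro r Z hZr
      rw [show (r : ℝ) * ((q * k : ℕ) : ℝ) = ((Z * k : ℤ) : ℝ) by push_cast; rw [hZr]; ring, Int.floor_intCast]
    simp only [arcA_eq_rowIcc, e ra A eA, e rb B eB, e rc Cc eC, e ry Y eY]

/-- **The crux reduces to integer marks** (`stub_equivalence` + `collinearCardy_iff_int`). [folklore] -/
theorem halfPlaneMarkDensityLaw_iff_int :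
    HalfPlaneMarkDensityLaw ↔
    ∀ A B C Y : ℤ, A < B → B < C → C < Y →
      Tendsto (fun N : ℕ ↦ μ.real (openCrossing halfPlane (rowIcc (A * N) (B * N)) (rowIcc (C * N) (Y * N))))
        atTop (𝓝 (𝔽 (crossRatio ![(A : ℝ), B, C, Y]))) :=
  stub_equivalence.trans collinearCardy_iff_int

end Subseq

/-- **Registered extra stub of line `Sketch` (lead c2-0): the crux reduces to INTEGER marks.**
`HalfPlaneMarkDensityLaw ⟺ ∀ A<B<C<Y : ℤ, P_{1/2}[[AN,BN]×{0} ↔ [CN,YN]×{0} in ℤ×ℕ] → F(η(A,B,C,Y))`.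
[folklore] -/
theorem stub_integerMarks :
    HalfPlaneMarkDensityLaw ↔
    ∀ A B C Y : ℤ, A < B → B < C → C < Y →
      Tendsto (fun N : ℕ ↦ μ.real (openCrossing halfPlane (rowIcc (A * N) (B * N)) (rowIcc (C * N) (Y * N))))
        atTop (𝓝 (Literature.Probability.RandomPlanarGeometry.cardyFunction
          (Literature.Probability.RandomPlanarGeometry.crossRatio ![(A : ℝ), B, C, Y]))) :=
  Subseq.halfPlaneMarkDensityLaw_iff_int

end Summit.CriticalPhenomena.CardyFormulaZ2.Cruxes.HalfPlaneMarkDensityLaw.SketchLine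

end
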